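import Summits.CriticalPhenomena.PercolationContinuityZ3.Theorems.PercNearOneGluingNoHeavyQuantOneBigCert
import HarnessLib

/-!
# QUANT lane R8, Conjecture DIB\* — CELL F2 ('exactly two blobs of size > j/2') REDUCED TO ONE REAL INEQUALITY (`TwoBigCertAt`)

builds on p205010 (kernel theorem, internal audit signed; external expert review pending)

Statement + support file (`--supports stmt-CriticalPhenomena-4575`), QUANT lane lead (gen 19); memo
`run/shared/lean/prim/quant/prim-quant-lead-g19/LEAD-NOTES-G19.md` N38–N39 and `prim-quant-lead-g19/FOR-PROVERS-F2.md`.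
TWO `Prop` definitions (`TwoBigCertAt b₁ b₂ j`, a closed-form real inequality indexed by the two big sizes and the layer, and the
`@[conjecture]` `TwoBigCert := ∀ b₁ b₂ j, TwoBigCertAt b₁ b₂ j`), theorems otherwise; no sorries, standard axioms.  Companion of `…QuantOneBig` /
`…QuantOneBigCert` (cell F1, lead g19) — same architecture with the B/S identity on the PAIR of bigs (`term_cond` twice; the branch 'both open'
is sure since `b₁ + b₂ ≥ j + 1`).

THE CELL.  Floor `1/2 ≤ x < 1`; gates in `[x², 1]`; TWO blobs `k₁ ≠ k₂` with `j < 2·a kᵢ ≤ 2j`, every other blob of size `≤ j/2` (the cloud);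
credit `> 2j`.  `P(N ≥ j+1) = p₁p₂ + p₁q₂·TERM[b₁, cloud] + q₁p₂·TERM[b₂, cloud] + q₁q₂·TERM[0, cloud]`, the three cloud terms bounded by the
menu 0 | Markov | Cantelli (`RootDec.term_ge_of_menu`) in the cloud's aggregates (`A, m, S₂, V, c`), which satisfy the constraints of
`…QuantOneBig` (`phi_le_gate`, `gate_ge_floorSq_add`, `gate_var_le`, sizes `≤ j/2`).

* `Quant.IndepBlob.TwoBigCertAt b₁ b₂ j` — the real inequality for big sizes `b₁, b₂` at layer `j`; `Quant.IndepBlob.TwoBigCert` (`@[conjecture]`).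
  NUMERICS (lead g19 explore/f2red.py, after the monotonicity reductions of `…QuantOneBigCert`): a 5-variable inequality (x, b₁/j, b₂/j, and the
  two gates) with minimum margin ≈ 0.30(1−x) at x ≈ 0.53, b₁ = b₂ = j, both bigs light; robust as x → 1 (margin → 2/3).  NOT PROVED here in general.
* **`Quant.RootDec.twoBig_row_of_certAt : TwoBigCertAt (a k₁) (a k₂) j → (the DIB\* row for that system)`** — the kernel reduction.
[this work]; the gluing rows served [cite: KozmaNitzan2024, Conjecture 3 (p. 15)]; product weights [cite: Grimmett1999, §1.3 p. 10].
-/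

namespace Summit.CriticalPhenomena.PercolationContinuityZ3.Theorems

namespace Quant

open Finset

namespace IndepBlob

/-- **THE F2 CERTIFICATE for big sizes `b₁, b₂` at layer `j`** (a closed-form real inequality; lead g19).  Data: floor `x`, the bigs' gates
`p₁, p₂`, the cloud aggregates `A` (total), `m` (mean), `s2 = Σ a g(1−g)`, `V = Σ a² g(1−g)`, `c` (discounted credit).  Hypotheses = the credit
hypothesis split at the two bigs + the aggregate constraints.  Conclusion: menu items `z₁` (level `j − b₁`), `z₂` (level `j − b₂`), `z₀` (level `j`),
each 0 | Markov | Cantelli, with `x ≤ p₁p₂ + p₁(1−p₂)z₁ + (1−p₁)p₂z₂ + (1−p₁)(1−p₂)z₀`. [this work] -/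
def TwoBigCertAt (b₁ b₂ j : ℕ) : Prop :=
  ∀ (x p₁ p₂ A m s2 V c : ℝ),
    1 / 2 ≤ x → x < 1 → x ^ 2 ≤ p₁ → p₁ ≤ 1 → x ^ 2 ≤ p₂ → p₂ ≤ 1 →
    j < 2 * b₁ → b₁ ≤ j → j < 2 * b₂ → b₂ ≤ j →
    (2 * j : ℝ) < (b₁ : ℝ) * (if x ≤ p₁ then p₁ else (p₁ - x ^ 2) / (1 - x))
      + (b₂ : ℝ) * (if x ≤ p₂ then p₂ else (p₂ - x ^ 2) / (1 - x)) + c →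
    c ≤ m → x ^ 2 * A + (1 - x) * c ≤ m → m ≤ A →
    0 ≤ V → 0 ≤ s2 → s2 ≤ (1 - x) * (2 * m - c) → s2 ≤ m → s2 ≤ A - m →
    V ≤ ((j : ℝ) / 2) * s2 →
    ∃ z₁ z₂ z₀ : ℝ,
      (z₁ ≤ 0 ∨ (((j - b₁ : ℕ) : ℝ) < A ∧ z₁ ≤ 1 - (A - m) / (A - ((j - b₁ : ℕ) : ℝ)))
        ∨ (((j - b₁ : ℕ) : ℝ) < m ∧ z₁ ≤ 1 - V / (V + (m - ((j - b₁ : ℕ) : ℝ)) ^ 2))) ∧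
      (z₂ ≤ 0 ∨ (((j - b₂ : ℕ) : ℝ) < A ∧ z₂ ≤ 1 - (A - m) / (A - ((j - b₂ : ℕ) : ℝ)))
        ∨ (((j - b₂ : ℕ) : ℝ) < m ∧ z₂ ≤ 1 - V / (V + (m - ((j - b₂ : ℕ) : ℝ)) ^ 2))) ∧
      (z₀ ≤ 0 ∨ ((j : ℝ) < A ∧ z₀ ≤ 1 - (A - m) / (A - j)) ∨ ((j : ℝ) < m ∧ z₀ ≤ 1 - V / (V + (m - j) ^ 2))) ∧
      x ≤ p₁ * p₂ + p₁ * (1 - p₂) * z₁ + (1 - p₁) * p₂ * z₂ + (1 - p₁) * (1 - p₂) * z₀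

/-- **CONJECTURE — the F2 certificate for all big sizes** (lead g19; FOR-PROVERS-F2.md): `∀ b₁ b₂ j, TwoBigCertAt b₁ b₂ j`.  The instance
`b₁ = b₂ = j` (two full-size bigs) is the lead's next kernel target; the general case is a 5-variable polynomial problem.  builds on p205010
(kernel theorem, internal audit signed; external expert review pending). [this work] [status: open] -/
@[conjecture] def TwoBigCert : Prop := ∀ b₁ b₂ j : ℕ, TwoBigCertAt b₁ b₂ j

end IndepBlob

namespace RootDec

variable {κ : Type} [Fintype κ] [DecidableEq κ]

/-- product-Bernoulli weight of the set `W` of open blobs (as in `…QuantRootReduction`) -/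
local notation3 "wt[" g ", " W "]" => ∏ k, (if k ∈ (W : Finset κ) then (g : κ → ℝ) k else 1 - (g : κ → ℝ) k)

/-- the TERM tail `P(s + Σ_{k open} a k ≥ j+1)` (as in `…QuantRootReduction`) -/
local notation3 "TERM[" s ", " a ", " g ", " j "]" =>
  ∑ W : Finset κ, wt[g, W] * (if (j : ℕ) + 1 ≤ (s : ℕ) + ∑ k ∈ W, (a : κ → ℕ) k then (1 : ℝ) else 0)

/-- A three-way menu (0 | Markov | Cantelli) is a four-way menu of `term_ge_of_menu` with `G = ∅`. [this work] -/
theorem term_ge_of_menu3 (s : ℕ) (a : κ → ℕ) (g : κ → ℝ) (j : ℕ) (hg : ∀ i, 0 ≤ g i ∧ g i ≤ 1) (hs : s ≤ j) (t : ℝ)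
    (ht : ((j - s : ℕ) : ℝ) = t) (x z : ℝ)
    (hz : z ≤ 0 ∨ (t < ∑ i, (a i : ℝ) ∧ z ≤ 1 - ((∑ i, (a i : ℝ)) - ∑ i, (a i : ℝ) * g i) / ((∑ i, (a i : ℝ)) - t))
        ∨ (t < ∑ i, (a i : ℝ) * g i ∧ z ≤ 1 - (∑ i, (a i : ℝ) ^ 2 * g i * (1 - g i)) /
            ((∑ i, (a i : ℝ) ^ 2 * g i * (1 - g i)) + ((∑ i, (a i : ℝ) * g i) - t) ^ 2))) :
    z ≤ TERM[s, a, g, j] := by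
  refine term_ge_of_menu s a g j hg hs t ht x z ∅ (fun i hi => absurd hi (Finset.notMem_empty i))
    (fun i hi => absurd hi (Finset.notMem_empty i)) ?_
  rcases hz with h | h | h
  · exact Or.inl h
  · exact Or.inr (Or.inl h)
  · exact Or.inr (Or.inr (Or.inl h))

/-- **CELL F2 REDUCED: `TwoBigCertAt (a k₁) (a k₂) j` ⟹ the DIB\* row for a system with exactly two blobs of size `> j/2`** (floor `1/2 ≤ x < 1`,
gates in `[x², 1]`, bigs `k₁ ≠ k₂` with `j < 2·a kᵢ ≤ 2j`, all other sizes `≤ j/2`, credit `> 2j`). [this work] -/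
theorem twoBig_row_of_certAt (a : κ → ℕ) (g : κ → ℝ) (j : ℕ) (x : ℝ) (hx : 1 / 2 ≤ x) (hx1 : x < 1)
    (hg : ∀ i, 0 ≤ g i ∧ g i ≤ 1) (hjunk : ∀ i, x ^ 2 ≤ g i) (k₁ k₂ : κ) (hne : k₁ ≠ k₂)
    (hbig₁ : j < 2 * a k₁) (hk₁j : a k₁ ≤ j) (hbig₂ : j < 2 * a k₂) (hk₂j : a k₂ ≤ j)
    (hsmall : ∀ i, i ≠ k₁ → i ≠ k₂ → 2 * a i ≤ j)
    (hcredit : (2 * j : ℝ) < ∑ i, (a i : ℝ) * (if x ≤ g i then g i else (g i - x ^ 2) / (1 - x)))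
    (hC : IndepBlob.TwoBigCertAt (a k₁) (a k₂) j) :
    x ≤ ∑ W : Finset κ, wt[g, W] * (if j + 1 ≤ ∑ i ∈ W, a i then (1 : ℝ) else 0) := by
  have hx0 : 0 ≤ x := by linarith
  set φ : κ → ℝ := fun i => if x ≤ g i then g i else (g i - x ^ 2) / (1 - x) with hφ
  set b₁ : ℕ := a k₁ with hb₁
  set b₂ : ℕ := a k₂ with hb₂
  set a' : κ → ℕ := Function.update a k₁ 0 with ha'
  set a'' : κ → ℕ := Function.update a' k₂ 0 with ha''
  have ha'k₂ : a' k₂ = b₂ := by simp [ha', Function.update_of_ne hne.symm, hb₂]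
  have ha''k₁ : a'' k₁ = 0 := by simp [ha'', Function.update_of_ne hne, ha']
  have ha''k₂ : a'' k₂ = 0 := by simp [ha'']
  have ha''ne : ∀ i, i ≠ k₁ → i ≠ k₂ → a'' i = a i := fun i h1 h2 => by
    simp [ha'', Function.update_of_ne h2, ha', Function.update_of_ne h1]
  have ha''half : ∀ i, 2 * a'' i ≤ j := by
    intro i
    by_cases h1 : i = k₁
    · rw [h1, ha''k₁]; exact Nat.zero_le _
    by_cases h2 : i = k₂
    · rw [h2, ha''k₂]; exact Nat.zero_le _
    rw [ha''ne i h1 h2]; exact hsmall i h1 h2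
  -- split P(N ≥ j+1) at the two bigs
  have e1 := term_cond 0 a g j k₁
  simp only [zero_add] at e1
  have e2 := term_cond b₁ a' g j k₂
  have e3 := term_cond 0 a' g j k₂
  simp only [zero_add] at e3
  rw [ha'k₂] at e2 e3
  have hsure : TERM[b₁ + b₂, a'', g, j] = 1 := term_eq_one_of_sure _ _ g j (by omega)
  rw [e1, show a k₁ = b₁ from rfl, show Function.update a k₁ 0 = a' from rfl, e2, e3, hsure,
    show Function.update a' k₂ 0 = a'' from rfl]
  -- the credit of the cloud
  have hrest : ∑ i, (a'' i : ℝ) * φ i = (∑ i, (a i : ℝ) * φ i) - b₁ * φ k₁ - b₂ * φ k₂ := by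
    have hmem : k₂ ∈ Finset.univ.erase k₁ := Finset.mem_erase.2 ⟨hne.symm, Finset.mem_univ _⟩
    have split : ∀ f : κ → ℝ, ∑ i, f i = f k₁ + (f k₂ + ∑ i ∈ (Finset.univ.erase k₁).erase k₂, f i) := by
      intro f
      rw [← Finset.add_sum_erase _ _ (Finset.mem_univ k₁), ← Finset.add_sum_erase _ _ hmem]
    have h3 : ∑ i ∈ (Finset.univ.erase k₁).erase k₂, (a'' i : ℝ) * φ i = ∑ i ∈ (Finset.univ.erase k₁).erase k₂, (a i : ℝ) * φ i :=
      Finset.sum_congr rfl fun i hi => by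
        rw [ha''ne i (Finset.ne_of_mem_erase (Finset.mem_of_mem_erase hi)) (Finset.ne_of_mem_erase hi)]
    rw [split (fun i => (a'' i : ℝ) * φ i), split (fun i => (a i : ℝ) * φ i), h3, ha''k₁, ha''k₂, Nat.cast_zero, zero_mul,
      zero_mul, zero_add, zero_add, hb₁, hb₂]
    ring
  -- pointwise facts about the cloud
  have ha0 : ∀ i, (0 : ℝ) ≤ a'' i := fun i => Nat.cast_nonneg _
  have hgg : ∀ i, 0 ≤ g i * (1 - g i) := fun i => mul_nonneg (hg i).1 (sub_nonneg.2 (hg i).2)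
  have hag : ∀ i, 0 ≤ (a'' i : ℝ) * g i := fun i => mul_nonneg (ha0 i) (hg i).1
  have hc1 : ∑ i, (a'' i : ℝ) * φ i ≤ ∑ i, (a'' i : ℝ) * g i := Finset.sum_le_sum fun i _ =>
    mul_le_mul_of_nonneg_left (IndepBlob.phi_le_gate x (g i) hx0 hx1) (ha0 i)
  have hc2 : x ^ 2 * (∑ i, (a'' i : ℝ)) + (1 - x) * (∑ i, (a'' i : ℝ) * φ i) ≤ ∑ i, (a'' i : ℝ) * g i := by
    rw [Finset.mul_sum, Finset.mul_sum, ← Finset.sum_add_distrib]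
    refine Finset.sum_le_sum fun i _ => ?_
    have h := mul_le_mul_of_nonneg_left (IndepBlob.gate_ge_floorSq_add x (g i) hx0 hx1) (ha0 i)
    have e : x ^ 2 * (a'' i : ℝ) + (1 - x) * ((a'' i : ℝ) * φ i) = (a'' i : ℝ) * (x ^ 2 + (1 - x) * φ i) := by ring
    rw [e]; exact h
  have hc3 : ∑ i, (a'' i : ℝ) * g i * (1 - g i) ≤ (1 - x) * (2 * (∑ i, (a'' i : ℝ) * g i) - ∑ i, (a'' i : ℝ) * φ i) := by
    rw [Finset.mul_sum, ← Finset.sum_sub_distrib, Finset.mul_sum]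
    refine Finset.sum_le_sum fun i _ => ?_
    have h := mul_le_mul_of_nonneg_left (IndepBlob.gate_var_le x (g i) hx0 hx1) (ha0 i)
    have e1' : (a'' i : ℝ) * g i * (1 - g i) = (a'' i : ℝ) * (g i * (1 - g i)) := by ring
    have e2' : (1 - x) * (2 * ((a'' i : ℝ) * g i) - (a'' i : ℝ) * φ i) = (a'' i : ℝ) * ((1 - x) * (2 * g i - φ i)) := by ring
    rw [e1', e2']; exact h
  have hs2m : ∑ i, (a'' i : ℝ) * g i * (1 - g i) ≤ ∑ i, (a'' i : ℝ) * g i :=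
    Finset.sum_le_sum fun i _ => by nlinarith [hag i, (hg i).1, (hg i).2]
  have hs2E : ∑ i, (a'' i : ℝ) * g i * (1 - g i) ≤ (∑ i, (a'' i : ℝ)) - ∑ i, (a'' i : ℝ) * g i := by
    rw [← Finset.sum_sub_distrib]
    exact Finset.sum_le_sum fun i _ => by nlinarith [mul_nonneg (ha0 i) (sq_nonneg (1 - g i))]
  have hs20 : 0 ≤ ∑ i, (a'' i : ℝ) * g i * (1 - g i) :=
    Finset.sum_nonneg fun i _ => by rw [mul_assoc]; exact mul_nonneg (ha0 i) (hgg i)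
  have hV0 : 0 ≤ ∑ i, (a'' i : ℝ) ^ 2 * g i * (1 - g i) :=
    Finset.sum_nonneg fun i _ => by rw [mul_assoc]; exact mul_nonneg (sq_nonneg _) (hgg i)
  have hmA : ∑ i, (a'' i : ℝ) * g i ≤ ∑ i, (a'' i : ℝ) :=
    Finset.sum_le_sum fun i _ => by nlinarith [ha0 i, (hg i).2]
  have hc4 : ∑ i, (a'' i : ℝ) ^ 2 * g i * (1 - g i) ≤ ((j : ℝ) / 2) * ∑ i, (a'' i : ℝ) * g i * (1 - g i) := by
    rw [Finset.mul_sum]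
    refine Finset.sum_le_sum fun i _ => ?_
    have h : 2 * (a'' i : ℝ) ≤ j := by exact_mod_cast ha''half i
    have h1 : (a'' i : ℝ) ^ 2 ≤ ((j : ℝ) / 2) * (a'' i : ℝ) := by nlinarith [ha0 i]
    have e1' : (a'' i : ℝ) ^ 2 * g i * (1 - g i) = (a'' i : ℝ) ^ 2 * (g i * (1 - g i)) := by ring
    have e2' : ((j : ℝ) / 2) * ((a'' i : ℝ) * g i * (1 - g i)) = (((j : ℝ) / 2) * (a'' i : ℝ)) * (g i * (1 - g i)) := by ring
    rw [e1', e2']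
    exact mul_le_mul_of_nonneg_right h1 (hgg i)
  -- the certificate
  have hcred' : (2 * j : ℝ) < (b₁ : ℝ) * φ k₁ + (b₂ : ℝ) * φ k₂ + ∑ i, (a'' i : ℝ) * φ i := by rw [hrest]; linarith
  have hφ₁ : φ k₁ = (if x ≤ g k₁ then g k₁ else (g k₁ - x ^ 2) / (1 - x)) := rfl
  have hφ₂ : φ k₂ = (if x ≤ g k₂ then g k₂ else (g k₂ - x ^ 2) / (1 - x)) := rfl
  rw [hφ₁, hφ₂] at hcred'
  obtain ⟨z₁, z₂, z₀, hz₁, hz₂, hz₀, hxz⟩ := hC x (g k₁) (g k₂) (∑ i, (a'' i : ℝ)) (∑ i, (a'' i : ℝ) * g i)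
    (∑ i, (a'' i : ℝ) * g i * (1 - g i)) (∑ i, (a'' i : ℝ) ^ 2 * g i * (1 - g i)) (∑ i, (a'' i : ℝ) * φ i)
    hx hx1 (hjunk k₁) (hg k₁).2 (hjunk k₂) (hg k₂).2 hbig₁ hk₁j hbig₂ hk₂j hcred' hc1 hc2 hmA hV0 hs20 hc3 hs2m hs2E hc4
  -- discharge the menu items
  have h1 : z₁ ≤ TERM[b₁, a'', g, j] := term_ge_of_menu3 b₁ a'' g j hg hk₁j _ rfl x z₁ hz₁
  have h2 : z₂ ≤ TERM[b₂, a'', g, j] := term_ge_of_menu3 b₂ a'' g j hg hk₂j _ rfl x z₂ hz₂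
  have h0 : z₀ ≤ ∑ W : Finset κ, wt[g, W] * (if j + 1 ≤ ∑ i ∈ W, a'' i then (1 : ℝ) else 0) := by
    have h0' : z₀ ≤ TERM[0, a'', g, j] := term_ge_of_menu3 0 a'' g j hg (Nat.zero_le j) (j : ℝ) (by simp) x z₀ hz₀
    simpa only [zero_add] using h0'
  have hp1 : 0 ≤ g k₁ := (hg k₁).1
  have hp2 : 0 ≤ g k₂ := (hg k₂).1
  have hq1 : 0 ≤ 1 - g k₁ := sub_nonneg.2 (hg k₁).2
  have hq2 : 0 ≤ 1 - g k₂ := sub_nonneg.2 (hg k₂).2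
  have f1 := mul_le_mul_of_nonneg_left h1 (mul_nonneg hp1 hq2)
  have f2 := mul_le_mul_of_nonneg_left h2 (mul_nonneg hq1 hp2)
  have f0 := mul_le_mul_of_nonneg_left h0 (mul_nonneg hq1 hq2)
  linarith [f1, f2, f0, hxz]

end RootDec

end Quant

end Summit.CriticalPhenomena.PercolationContinuityZ3.Theorems
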